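import Summits.AtomisticToContinuum.HydrodynamicLimit.Theorems.AntiMazurCoboundariesKineticFluxLdDecayHTheoremObjectsC
import Summits.AtomisticToContinuum.HydrodynamicLimit.Theorems.AntiMazurCoboundariesKineticFluxLdDecayWindowDuality
import Summits.AtomisticToContinuum.HydrodynamicLimit.Theorems.AntiMazurCoboundariesKineticFluxLdDecayOneBodyMarginal
import Summits.AtomisticToContinuum.HydrodynamicLimit.Theorems.AntiMazurCoboundariesKineticFluxLdDecayVelocityEntropyBudget
import Summits.AtomisticToContinuum.HydrodynamicLimit.Theorems.AntiMazurCoboundariesKineticFluxLdDecayGainDominationLocal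
import Summits.AtomisticToContinuum.HydrodynamicLimit.Theorems.AntiMazurCoboundariesKineticFluxLdDecayPositionTailBudget
import HarnessLib

/-!
# The H-theorem reduction of the crux `KineticFluxLdDecay` (stmt-AtomisticToContinuum-10967):
# `NoPerpetualDissipationTilt → KineticFluxLdDecay` (both route copies), sorry-free

Line `h-theorem-dissipation-budget` (lead a2). With the provable stubs of the registered skeleton LANDED
(`stub_windowDuality`, `stub_oneBodyMarginal`, `stub_velocityEntropyBudget`, `stub_gainDominationLocal`,
`stub_positionTailBudget`), the crux follows from the single remaining stub, the bet
`C⁺_{K,X} = NoPerpetualDissipationTilt` (objects part C): the time-integrated Hellinger entropy production of the cut reduced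
one-body law of the crux's own tilted law `G_N^X` along the `N`-body flow is budgeted by its relative entropy. This file is
the kernel-checked normal form `crux ⟸ C⁺_{K,X}` (registered sub-goal `stub_hTheoremReduction : HTheoremReduction`):
Donsker–Varadhan at finite `N` (`log E_G e^X = E_{G^X}X − KL(G^X‖G)`), the gain identity through the one-body law, the gain
split at the density cut `{n_t ≤ K}`, the kinetic gain–dissipation lemma on the low-density fibres per time slice, AM–GM, the
velocity and position entropy budgets, and the choices `log K = 8κ₁ + 16κ₁/δ + 2`, `r = δ/(4C₁)`, `τ = 2C₁A/r + 4C₁B/(rδ) + 1`.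
Why the bet is stated for `G_N^X` only and with a cut: every `∀ν` form of a one-body entropy-production budget is false
(point-density and macrostate-mixture artefacts of Boltzmann's functional; `Cruxes/KineticFluxLdDecay/Lines/h_theorem_dissipation_budget.md`).
-/

noncomputable section

open MeasureTheory ProbabilityTheory Set Filter InformationTheory
open scoped ENNReal

namespace Summit.AtomisticToContinuum.HydrodynamicLimit.Theorems.HTheorem

open Literature.MathematicalPhysics.KineticTheory (T3 V3 hsDiameter localGibbsLaw)
open Literature.Analysis.FluidPDE (HardSphereFlow Config)

/-- Statement of the registered sub-goal `stub_hTheoremReduction`: **the bet alone implies the crux** (both route copies). -/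
def HTheoremReduction : Prop :=
  NoPerpetualDissipationTilt →
    Summit.AtomisticToContinuum.HydrodynamicLimit.Theses.AntiMazurCoboundaries.KineticFluxLdDecay ∧
      Summit.AtomisticToContinuum.HydrodynamicLimit.Theses.FluxGibbsianityLdDrude.KineticFluxLdDecay

namespace Reduction

/-- `ofReal ∫ f ≤ ∫⁻ ofReal f` for every real `f` (no sign or integrability hypothesis: the Bochner integral of
a non-integrable `f` is `0`, and `∫ f ≤ ∫ f⁺`). -/
theorem ofReal_integral_le_lintegral_ofReal_of_real {α : Type*} [MeasurableSpace α] {μ : Measure α}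
    (f : α → ℝ) : ENNReal.ofReal (∫ x, f x ∂μ) ≤ ∫⁻ x, ENNReal.ofReal (f x) ∂μ := by
  by_cases hfi : Integrable f μ
  · calc ENNReal.ofReal (∫ x, f x ∂μ) ≤ ENNReal.ofReal (∫ x, max (f x) 0 ∂μ) :=
          ENNReal.ofReal_le_ofReal (integral_mono hfi hfi.pos_part fun x => le_max_left _ _)
      _ = ∫⁻ x, ENNReal.ofReal (max (f x) 0) ∂μ :=
          ofReal_integral_eq_lintegral_ofReal hfi.pos_part (ae_of_all _ fun x => le_max_right _ _)
      _ = ∫⁻ x, ENNReal.ofReal (f x) ∂μ := lintegral_congr fun x => by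
          rcases le_total (f x) 0 with hx | hx
          · rw [max_eq_right hx, ENNReal.ofReal_zero, ENNReal.ofReal_of_nonpos hx]
          · rw [max_eq_left hx]
  · rw [integral_undef hfi, ENNReal.ofReal_zero]
    exact zero_le

/-- AM–GM in the form the composition uses: `√d ≤ d/(2r) + r/2` for `d ≥ 0`, `r > 0`. -/
theorem sqrt_le_amgm {d r : ℝ} (hd : 0 ≤ d) (hr : 0 < r) : Real.sqrt d ≤ d / (2 * r) + r / 2 := by
  rw [div_add_div _ _ (by positivity) two_ne_zero, le_div_iff₀ (by positivity)]
  nlinarith [sq_nonneg (Real.sqrt d - r), Real.sq_sqrt hd, Real.sqrt_nonneg d]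

/-- Integrability of the cut gain integrand `1_E(x) φ(x) g(w)` (bounded, measurable) on a finite measure. -/
theorem integrable_of_abs_le_mul {f : Measure (T3 × V3)} [IsFiniteMeasure f] {E : Set T3} (hE : MeasurableSet E)
    {φ : T3 → ℝ} {g : V3 → ℝ} {κ : ℝ} (hφm : Measurable φ) (hgm : Measurable g) (hφ : ∀ x, |φ x| ≤ 1)
    (hg : ∀ w, |g w| ≤ κ) : Integrable (fun y : T3 × V3 => Set.indicator E φ y.1 * g y.2) f := by
  refine (integrable_const κ).mono' ?_ (ae_of_all _ fun y => ?_)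
  · exact (((hφm.indicator hE).comp measurable_fst).mul (hgm.comp measurable_snd)).aestronglyMeasurable
  · rw [Real.norm_eq_abs, abs_mul]
    have h1 : |Set.indicator E φ y.1| ≤ 1 := by
      by_cases hy : y.1 ∈ E
      · rw [Set.indicator_of_mem hy]; exact hφ _
      · rw [Set.indicator_of_notMem hy, abs_zero]; exact zero_le_one
    exact (mul_le_mul h1 (hg _) (abs_nonneg _) zero_le_one).trans_eq (one_mul κ)

/-- The budget arithmetic: with `K, r, τ` chosen so that `2κ₁/log K ≤ ¼`, `4κ₁/log K ≤ δ/4`, `C₁A/(2rτ) ≤ ¼`,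
`C₁B/(2rτ) ≤ δ/8`, `C₁r/2 ≤ δ/8`, a gain bound
`X ≤ n(C₁r/2 + 4κ₁/log K) + S(½ + 2κ₁/log K) + (nC₁/(2r))·((A S/n + B)/τ)` gives `X − S ≤ δ n`. -/
theorem budget_arith {n C₁ r τ A B S δ X q : ℝ} (hn : 0 < n) (hr : 0 < r) (hτ : 0 < τ) (hS : 0 ≤ S)
    (hδ : 0 < δ) (hq1 : 2 * q ≤ 1 / 4) (hq2 : 4 * q ≤ δ / 4)
    (h1 : C₁ * A / (2 * r * τ) ≤ 1 / 4) (h2 : C₁ * B / (2 * r * τ) ≤ δ / 8) (h3 : C₁ * r / 2 ≤ δ / 8)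
    (hX : X ≤ n * (C₁ * r / 2 + 4 * q) + S * (1 / 2 + 2 * q) + n * C₁ / (2 * r) * ((A * S / n + B) / τ)) :
    X - S ≤ δ * n := by
  have e1 : n * C₁ / (2 * r) * ((A * S / n + B) / τ) =
      S * (C₁ * A / (2 * r * τ)) + n * (C₁ * B / (2 * r * τ)) := by
    field_simp
  rw [e1] at hX
  have i1 : S * (C₁ * A / (2 * r * τ)) ≤ S * (1 / 4) := mul_le_mul_of_nonneg_left h1 hS
  have i2 : n * (C₁ * B / (2 * r * τ)) ≤ n * (δ / 8) := mul_le_mul_of_nonneg_left h2 hn.le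
  have i3 : n * (C₁ * r / 2 + 4 * q) ≤ n * (δ / 8 + δ / 4) := mul_le_mul_of_nonneg_left (by linarith) hn.le
  have i4 : S * (1 / 2 + 2 * q) ≤ S * (1 / 2 + 1 / 4) := mul_le_mul_of_nonneg_left (by linarith) hS
  nlinarith

/-- The per-time arithmetic: from the kinetic gain bound on the low-density fibres `gainE ≤ C√d + ½·vk`, the gain
bound on the high-density fibres `gainH ≤ κ₁ m`, AM–GM `√d ≤ d/(2r) + r/2`, `C ≤ C₁`, the velocity entropy budget
`n·vk ≤ S` and the position tail budget `n·m ≤ 2(S + 2n)/L` (`L = log K`):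
`n(gainE + gainH) − (n(C₁r/2 + 4κ₁/L) + S(½ + 2κ₁/L)) ≤ (nC₁/(2r))·d`. -/
theorem perTime_arith {n C C₁ r d gainE gainH vk S κ₁ m L : ℝ} (hn : 0 < n) (hC₁ : C ≤ C₁) (hC₁0 : 0 ≤ C₁)
    (hr : 0 < r) (hκ₁ : 0 ≤ κ₁) (hL : 0 < L) (hsq : 0 ≤ Real.sqrt d)
    (hamgm : Real.sqrt d ≤ d / (2 * r) + r / 2)
    (hgain : gainE ≤ C * Real.sqrt d + 2⁻¹ * vk) (hhigh : gainH ≤ κ₁ * m) (hvel : n * vk ≤ S)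
    (htail : n * m ≤ 2 * (S + 2 * n) / L) :
    n * (gainE + gainH) - (n * (C₁ * r / 2 + 4 * (κ₁ / L)) + S * (1 / 2 + 2 * (κ₁ / L))) ≤
      n * C₁ / (2 * r) * d := by
  have h1 : gainE ≤ C₁ * (d / (2 * r) + r / 2) + 2⁻¹ * vk := by
    nlinarith [mul_le_mul_of_nonneg_left hamgm hC₁0, mul_le_mul_of_nonneg_right hC₁ hsq]
  have h2 : n * gainE ≤ n * (C₁ * (d / (2 * r) + r / 2) + 2⁻¹ * vk) := mul_le_mul_of_nonneg_left h1 hn.le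
  have h3 : n * gainH ≤ κ₁ * (n * m) := by nlinarith [mul_le_mul_of_nonneg_left hhigh hn.le]
  have h4 : κ₁ * (n * m) ≤ κ₁ * (2 * (S + 2 * n) / L) := mul_le_mul_of_nonneg_left htail hκ₁
  have e : n * C₁ / (2 * r) * d = n * (C₁ * (d / (2 * r))) := by
    field_simp
  have e2 : κ₁ * (2 * (S + 2 * n) / L) = S * (2 * (κ₁ / L)) + n * (4 * (κ₁ / L)) := by
    field_simp
    ring
  rw [e]
  nlinarith

/-- **The LD bound of the line, in the frame's vocabulary.** Under the stubs: for constant profiles `a, θ > 0`, `u₀`,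
there is `σ₀ > 0` such that for `0 < σ < σ₀` the global Gibbs laws are probability laws and, with the absolute amplitude
`κ₁` of `GainDominationLocal`, every admissible `φ, g` and `δ > 0` admit a window `τ` and `N₀` with
`E_{G_N} exp(X) ≤ e^{δ(N+1)}` for all `N ≥ N₀` and every flow. -/
theorem lintegral_exp_windowAvg_le (hA : WindowDuality) (hB : OneBodyMarginal)
    (hC : VelocityEntropyBudget) (hD : GainDominationLocal) (hP : PositionTailBudget)
    (hE : NoPerpetualDissipationTilt)
    (a θ : ℝ) (u₀ : V3) (ha : 0 < a) (hθ : 0 < θ) :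
    ∃ σ₀ : ℝ, 0 < σ₀ ∧ ∀ σ : ℝ, 0 < σ → σ < σ₀ →
      (∀ (N : ℕ) (Φ : Flow σ N), IsProbabilityMeasure (gibbs σ a θ u₀ N Φ)) ∧
      ∃ κ : ℝ, 0 < κ ∧ ∀ (φ : T3 → ℝ) (g : V3 → ℝ), Continuous φ → Continuous g →
        (∀ x, |φ x| ≤ 1) → (∀ v, |g v| ≤ κ) → Orthogonal g →
        ∀ δ : ℝ, 0 < δ → ∃ τ : ℝ, 0 < τ ∧ ∃ N₀ : ℕ, ∀ N : ℕ, N₀ ≤ N → ∀ Φ : Flow σ N,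
          ∫⁻ z, ENNReal.ofReal (Real.exp (windowAvg Φ (fluxObs θ u₀ φ g N) (window τ N) z))
              ∂(gibbs σ a θ u₀ N Φ) ≤ ENNReal.ofReal (Real.exp (δ * (N + 1))) := by
  obtain ⟨σ₁, hσ₁, hE1⟩ := hE a θ u₀ ha hθ
  obtain ⟨κ₁, hκ₁, hD1⟩ := hD
  refine ⟨min σ₁ (1 / 4), lt_min hσ₁ (by norm_num), fun σ hσ hσlt => ?_⟩
  have hσ1 : σ < σ₁ := hσlt.trans_le (min_le_left _ _)
  have hσ4 : σ ≤ 1 / 4 := (hσlt.trans_le (min_le_right _ _)).le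
  have hσ2 : σ ≤ 1 / 2 := hσ4.trans (by norm_num)
  obtain ⟨κb, hκb, hEb⟩ := hE1 σ hσ hσ1
  refine ⟨fun N Φ => isProbabilityMeasure_gibbs ha hθ hσ2 u₀ N Φ, min κ₁ κb, lt_min hκ₁ hκb, ?_⟩
  intro φ g hφ hg hφ1 hgκ' horth δ hδ
  have hgκ : ∀ v, |g v| ≤ κ₁ := fun v => (hgκ' v).trans (min_le_left _ _)
  have hgκb : ∀ v, |g v| ≤ κb := fun v => (hgκ' v).trans (min_le_right _ _)
  obtain ⟨C, hC0, hD2⟩ := hD1 g hg hgκ horth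
  -- constants: cut level `K = e^L`, then `A, B` from the bet, then `r`, `τ`
  set L : ℝ := 8 * κ₁ + 16 * κ₁ / δ + 2 with hLdef
  have hL0 : 0 < L := by positivity
  have hL2 : 2 ≤ L := by
    have : 0 ≤ 8 * κ₁ + 16 * κ₁ / δ := by positivity
    linarith
  have hq1 : 2 * (κ₁ / L) ≤ 1 / 4 := by
    rw [mul_div_assoc', div_le_iff₀ hL0]
    have : 0 ≤ 16 * κ₁ / δ := by positivity
    nlinarith
  have hq2 : 4 * (κ₁ / L) ≤ δ / 4 := by
    rw [mul_div_assoc', div_le_iff₀ hL0]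
    have h16 : 16 * κ₁ / δ * δ = 16 * κ₁ := by field_simp
    nlinarith [mul_le_mul_of_nonneg_right hL2 hδ.le]
  set K : ℝ := Real.exp L with hKdef
  have hK1 : 1 ≤ K := Real.one_le_exp hL0.le
  have hKe : Real.exp 2 ≤ K := Real.exp_le_exp.2 hL2
  have hlogK : Real.log K = L := Real.log_exp L
  obtain ⟨A, B, hA0, hB0, hE2⟩ := hEb φ g hφ hg hφ1 hgκb horth K hK1
  set C₁ : ℝ := C + 1 with hC₁
  have hC₁0 : 0 < C₁ := by positivity
  set r : ℝ := δ / (4 * C₁) with hr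
  have hr0 : 0 < r := by positivity
  set τ : ℝ := 2 * C₁ * A / r + 4 * C₁ * B / (r * δ) + 1 with hτdef
  have hτ : 0 < τ := by positivity
  have h1 : C₁ * A / (2 * r * τ) ≤ 1 / 4 := by
    rw [div_le_iff₀ (by positivity)]
    have : 2 * C₁ * A / r ≤ τ := by
      have : 0 ≤ 4 * C₁ * B / (r * δ) := by positivity
      linarith
    rw [div_le_iff₀ hr0] at this
    nlinarith
  have h2 : C₁ * B / (2 * r * τ) ≤ δ / 8 := by
    rw [div_le_iff₀ (by positivity)]
    have : 4 * C₁ * B / (r * δ) ≤ τ := by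
      have : 0 ≤ 2 * C₁ * A / r := by positivity
      linarith
    rw [div_le_iff₀ (by positivity)] at this
    nlinarith
  have h3 : C₁ * r / 2 ≤ δ / 8 := by
    rw [hr]
    field_simp
    nlinarith
  obtain ⟨N₀, hE3⟩ := hE2 τ hτ
  refine ⟨τ, hτ, N₀, fun N hN Φ => ?_⟩
  -- frame at fixed `N`, `Φ`
  haveI hGP : IsProbabilityMeasure (gibbs σ a θ u₀ N Φ) := isProbabilityMeasure_gibbs ha hθ hσ2 u₀ N Φ
  have hgood : gibbs σ a θ u₀ N Φ Φ.goodᶜ = 0 :=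
    gibbs_absolutelyContinuous σ a θ u₀ N Φ Φ.measure_compl_good
  have hFm : Measurable (fluxObs θ u₀ φ g N) := measurable_fluxObs θ u₀ hφ.measurable hg.measurable N
  have hFb : ∀ z, |fluxObs θ u₀ φ g N z| ≤ ((N + 1 : ℕ) : ℝ) * κ₁ := abs_fluxObs_le θ u₀ hφ1 hgκ N
  have hh : 0 < window τ N := mul_pos hτ (Real.rpow_pos_of_pos (by positivity) _)
  obtain ⟨hνP, hνac, hνkl, hlhs, hii, hfub⟩ :=
    hA _ _ Φ (gibbs σ a θ u₀ N Φ) hGP hgood (fluxObs θ u₀ φ g N) hFm ⟨_, hFb⟩ (window τ N) hh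
  -- abbreviations
  set G : Measure (Phase N) := gibbs σ a θ u₀ N Φ with hGdef
  set F : Phase N → ℝ := fluxObs θ u₀ φ g N with hFdef
  set h : ℝ := window τ N with hhdef
  set ν : Measure (Phase N) := G.tilted (windowAvg Φ F h) with hνdef
  haveI : IsProbabilityMeasure ν := hνP
  rw [hlhs]
  refine ENNReal.ofReal_le_ofReal (Real.exp_le_exp.2 ?_)
  set S : ℝ := (klDiv ν G).toReal with hSdef
  have hS0 : 0 ≤ S := ENNReal.toReal_nonneg
  have hn : (0 : ℝ) < ((N + 1 : ℕ) : ℝ) := by positivity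
  -- the per-time gain bound, in `∫⁻` currency
  set k : ℝ := ((N + 1 : ℕ) : ℝ) * (C₁ * r / 2 + 4 * (κ₁ / L)) + S * (1 / 2 + 2 * (κ₁ / L)) with hkdef
  set c : ℝ := ((N + 1 : ℕ) : ℝ) * C₁ / (2 * r) with hcdef
  have hc0 : 0 < c := by positivity
  have key : ∀ t : ℝ, ENNReal.ofReal ((∫ z, F (Φ.flow t z) ∂ν) - k) ≤
      ENNReal.ofReal c * production (cutDensity K θ u₀ Φ ν t) := by
    intro t
    obtain ⟨hfP, hfac, hid⟩ := hB σ a θ u₀ N Φ ν hνP hθ hνac t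
    obtain ⟨hvk, hvel⟩ := hC σ a θ u₀ N Φ ν hνP ha hθ hσ2 hνac hνkl t
    have htail := hP σ a θ u₀ N Φ ν hνP ha hθ hσ hσ2 hνac hνkl t K hKe
    rw [hlogK] at htail
    rw [hid φ g hφ.measurable hg.measurable ⟨1, hφ1⟩ ⟨κ₁, hgκ⟩]
    -- split the gain at the cut `E = {n_t ≤ K}`
    set f : Measure (T3 × V3) := oneBodyLaw θ u₀ Φ ν t with hfdef
    haveI : IsProbabilityMeasure f := hfP
    set E : Set T3 := {x | posDensity θ u₀ Φ ν t x ≤ K} with hEdef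
    have hEm : MeasurableSet E := measurableSet_posDensity_le θ u₀ Φ ν t K
    have hsplit : ∫ y, φ y.1 * g y.2 ∂f =
        (∫ y, Set.indicator E φ y.1 * g y.2 ∂f) + ∫ y, Set.indicator Eᶜ φ y.1 * g y.2 ∂f := by
      have hind : ∀ x, Set.indicator E φ x + Set.indicator Eᶜ φ x = φ x := fun x => by
        by_cases hx : x ∈ E
        · rw [Set.indicator_of_mem hx, Set.indicator_of_notMem (fun h : x ∈ Eᶜ => h hx), add_zero]
        · rw [Set.indicator_of_notMem hx, Set.indicator_of_mem (Set.mem_compl hx), zero_add]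
      rw [← integral_add]
      · refine integral_congr_ae (ae_of_all _ fun y => ?_)
        show φ y.1 * g y.2 = Set.indicator E φ y.1 * g y.2 + Set.indicator Eᶜ φ y.1 * g y.2
        rw [← add_mul, hind]
      · exact integrable_of_abs_le_mul hEm hφ.measurable hg.measurable hφ1 hgκ
      · exact integrable_of_abs_le_mul hEm.compl hφ.measurable hg.measurable hφ1 hgκ
    have hhigh : ∫ y, Set.indicator Eᶜ φ y.1 * g y.2 ∂f ≤ κ₁ * (f.fst Eᶜ).toReal :=
      integral_indicator_compl_mul_le hφ1 hgκ hEm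
    have hEc : f.fst Eᶜ = f.fst {x | K < posDensity θ u₀ Φ ν t x} := by
      congr 1
      ext x
      simp [hEdef]
    rw [hEc] at hhigh
    by_cases htop : production (cutDensity K θ u₀ Φ ν t) = ⊤
    · rw [htop, ENNReal.mul_top (by simpa using hc0)]
      exact le_top
    · obtain ⟨d, hd0, hdeq⟩ : ∃ d : ℝ, 0 ≤ d ∧ production (cutDensity K θ u₀ Φ ν t) = ENNReal.ofReal d :=
        ⟨_, ENNReal.toReal_nonneg, (ENNReal.ofReal_toReal htop).symm⟩
      have hdle : production (Set.indicator (E ×ˢ Set.univ) (fun y => (f.rnDeriv refMeasure y).toReal)) ≤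
          ENNReal.ofReal d := hdeq.le
      have hgain := hD2 φ hφ.measurable hφ1 E hEm f hfP hfac hvk d hd0 hdle
      have hmain := perTime_arith (C := C) (C₁ := C₁) hn (by linarith only [hC₁]) hC₁0.le hr0 hκ₁.le hL0
        (Real.sqrt_nonneg d) (sqrt_le_amgm hd0 hr0) hgain hhigh hvel htail
      rw [hsplit]
      calc ENNReal.ofReal (((N + 1 : ℕ) : ℝ) * ((∫ y, Set.indicator E φ y.1 * g y.2 ∂f) +
              ∫ y, Set.indicator Eᶜ φ y.1 * g y.2 ∂f) - k)
          ≤ ENNReal.ofReal (c * d) := ENNReal.ofReal_le_ofReal hmain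
        _ = ENNReal.ofReal c * production (cutDensity K θ u₀ Φ ν t) := by
          rw [ENNReal.ofReal_mul hc0.le, hdeq]
  -- integrate over the window and insert `C⁺_K`
  have hint : ∫⁻ t in Set.Ioo 0 h, ENNReal.ofReal ((∫ z, F (Φ.flow t z) ∂ν) - k) ≤
      ENNReal.ofReal c * ENNReal.ofReal (h / τ * (A * S / ((N + 1 : ℕ) : ℝ) + B)) := by
    calc ∫⁻ t in Set.Ioo 0 h, ENNReal.ofReal ((∫ z, F (Φ.flow t z) ∂ν) - k)
        ≤ ∫⁻ t in Set.Ioo 0 h, ENNReal.ofReal c * production (cutDensity K θ u₀ Φ ν t) :=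
          lintegral_mono fun t => key t
      _ = ENNReal.ofReal c * ∫⁻ t in Set.Ioo 0 h, production (cutDensity K θ u₀ Φ ν t) :=
          lintegral_const_mul' _ _ ENNReal.ofReal_ne_top
      _ ≤ ENNReal.ofReal c * ENNReal.ofReal (h / τ * (A * S / ((N + 1 : ℕ) : ℝ) + B)) := by
          gcongr
          exact hE3 N hN Φ
  -- back to Bochner integrals
  have hB1 : ENNReal.ofReal (∫ t in Set.Ioo 0 h, ((∫ z, F (Φ.flow t z) ∂ν) - k)) ≤
      ∫⁻ t in Set.Ioo 0 h, ENNReal.ofReal ((∫ z, F (Φ.flow t z) ∂ν) - k) :=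
    ofReal_integral_le_lintegral_ofReal_of_real _
  have hB2 : ∫ t in Set.Ioo 0 h, ((∫ z, F (Φ.flow t z) ∂ν) - k) =
      (∫ t in (0 : ℝ)..h, ∫ z, F (Φ.flow t z) ∂ν) - h * k := by
    rw [← integral_Ioc_eq_integral_Ioo, ← intervalIntegral.integral_of_le hh.le,
      intervalIntegral.integral_sub hii intervalIntegrable_const, intervalIntegral.integral_const,
      sub_zero, smul_eq_mul]
  have hRHS0 : 0 ≤ c * (h / τ * (A * S / ((N + 1 : ℕ) : ℝ) + B)) := by positivity
  have hB3 : (∫ t in (0 : ℝ)..h, ∫ z, F (Φ.flow t z) ∂ν) - h * k ≤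
      c * (h / τ * (A * S / ((N + 1 : ℕ) : ℝ) + B)) := by
    rw [← hB2, ← ENNReal.ofReal_le_ofReal_iff hRHS0, ENNReal.ofReal_mul hc0.le]
    exact hB1.trans hint
  -- the gain bound for `X`
  have hX : ∫ z, windowAvg Φ F h z ∂ν ≤
      ((N + 1 : ℕ) : ℝ) * (C₁ * r / 2 + 4 * (κ₁ / L)) + S * (1 / 2 + 2 * (κ₁ / L)) +
        ((N + 1 : ℕ) : ℝ) * C₁ / (2 * r) * ((A * S / ((N + 1 : ℕ) : ℝ) + B) / τ) := by
    rw [hfub]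
    have e : h⁻¹ * (h * k + c * (h / τ * (A * S / ((N + 1 : ℕ) : ℝ) + B))) =
        k + c * ((A * S / ((N + 1 : ℕ) : ℝ) + B) / τ) := by
      field_simp
    calc h⁻¹ * ∫ t in (0 : ℝ)..h, ∫ z, F (Φ.flow t z) ∂ν
        ≤ h⁻¹ * (h * k + c * (h / τ * (A * S / ((N + 1 : ℕ) : ℝ) + B))) :=
          mul_le_mul_of_nonneg_left (by linarith only [hB3]) (inv_nonneg.2 hh.le)
      _ = k + c * ((A * S / ((N + 1 : ℕ) : ℝ) + B) / τ) := e
      _ = _ := by rw [hkdef, hcdef]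
  have hfin := budget_arith hn hr0 hτ hS0 hδ hq1 hq2 h1 h2 h3 hX
  calc (∫ z, windowAvg Φ F h z ∂ν) - (klDiv ν G).toReal ≤ δ * ((N + 1 : ℕ) : ℝ) := hfin
    _ = δ * (N + 1) := by push_cast; ring

end Reduction

/-- **The H-theorem reduction** (registered sub-goal): `NoPerpetualDissipationTilt → KineticFluxLdDecay` for both route
copies, from the five landed stubs. -/
theorem stub_hTheoremReduction : HTheoremReduction := fun hE =>
  ⟨fun a θ u₀ ha hθ => Reduction.lintegral_exp_windowAvg_le stub_windowDuality stub_oneBodyMarginal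
      stub_velocityEntropyBudget stub_gainDominationLocal stub_positionTailBudget hE a θ u₀ ha hθ,
    fun a θ u₀ ha hθ => Reduction.lintegral_exp_windowAvg_le stub_windowDuality stub_oneBodyMarginal
      stub_velocityEntropyBudget stub_gainDominationLocal stub_positionTailBudget hE a θ u₀ ha hθ⟩

/-- The global kinetic lemma of the line (landed separately, p140248) is recorded here for the reader: it is the
case `E = univ` of the localised form the reduction consumes. -/
theorem gainDomination_of_line : GainDomination := stub_gainDomination

/-- Corollary in the shape the route files cite: the bet implies the AntiMazurCoboundaries copy of the crux. -/
theorem kineticFluxLdDecay_of_noPerpetualDissipationTilt (hE : NoPerpetualDissipationTilt) :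
    Summit.AtomisticToContinuum.HydrodynamicLimit.Theses.AntiMazurCoboundaries.KineticFluxLdDecay :=
  (stub_hTheoremReduction hE).1

end Summit.AtomisticToContinuum.HydrodynamicLimit.Theorems.HTheorem

end
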